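import Mathlib
import Summits.CriticalPhenomena.CardyFormulaZ2.Theorems.CardyMagicRigidityNestingRigidityBondLoopTraversalCore
import Summits.CriticalPhenomena.CardyFormulaZ2.Theorems.CardyMagicRigidityNestingRigiditySoftMachineBond
import Literature.Probability.Percolation.AnnulusCrossingBoundProofs
import HarnessLib

/-!
# (H1) for bond-`ℤ²` interface loops, brick 5: the Aizenman–Burchard multiple-traversal estimate

Crux `Summit.CriticalPhenomena.CardyFormulaZ2.Theses.CardyMagicRigidity.NestingRigidity`
(stmt-CriticalPhenomena-4835), line `positive-cone-weight-doubling`.  Discharge of the registered stub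
`bond_loop_traversalBound` — hypothesis H1 of M. Aizenman, A. Burchard, Duke Math. J. 99 (1999), eq. (1.3)
and Appendix A, Thm A.1, for the system of ALL interface loops `IsInterfaceLoop (ω ∩ M) γ` of critical bond
percolation on `δℤ²` drawn as medial polygons `polyline ((γ ++ γ.take 1).map (medialPoint δ))`: there are a
threshold `k`, `K ≥ 0` and `λ > 2` with
`P_{1/2}(some interface loop of ω ∩ M traverses D(x; ρ, R) k times) ≤ K (ρ/R)^λ` for all `M`, `δ ∈ (0, 1]`,
`δ ≤ ρ < R ≤ 1`.  Proof: with `α, c₀` from the RSW one-crossing bound `annulusOpenCrossing_half_le_holds`,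
`j = ⌈3/α⌉₊`, `k = 2j + 3`, `λ = αj ≥ 3`, `C = max c₀ 1 + 40`, `K = (4C)^λ`.  For `R < 4Cρ` the bound is `≥ 1`.
Otherwise the traversals pass to the rounded Jordan loop of the orbit of the first corner of `γ` (brick 1,
shell `D(x; ρ + 5δ, R - 5δ)`), the deterministic core (brick 4, `q₁ = Cρ`, `q₂ = R - 5δ`) puts
`(ω ∩ M) ∩ E(ℤ²) ⊆ ω` — hence `ω`, the crossing event being increasing — in the `j`-fold disjoint occurrence
of the open crossing of `A(x; Cρ + 11δ, R - 16δ)`, of probability `≤ ((Cρ + 11δ)/(R - 16δ))^{αj} ≤ K (ρ/R)^λ`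
by the iterated van den Berg–Kesten–Reimer inequality `measureReal_disjointOccurrencePow_le`.  Corollary
(`precompactLaw_measurable_zEns`, registered anchor): the UNCONDITIONAL `d_CN`-precompactness of the critical
`ℤ²` bond loop ensemble `zEns` with measurable closeness events, by
`precompactLaw_measurable_zEns_of_traversalBound` (`…SoftMachineBond.lean`).
-/

noncomputable section

open MeasureTheory Set Filter Metric TopologicalSpace Function
open scoped Topology ENNReal NNReal unitInterval

namespace Summit.CriticalPhenomena.CardyFormulaZ2.Cruxes.NestingRigidity.PositiveConeWeightDoubling

open Literature.Probability.RandomPlanarGeometry Literature.Probability.Percolation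
  Literature.Probability.LatticeModels

/-! Local notations (no definitions are introduced): the rounded Jordan loop of the orbit of the corner `p`
of `β` at mesh `δ`, read on `[0, 1]`, and the index `⌊Q t⌋` of the current dart at time `t`. -/
local notation3 "RC[" β ", " p ", " δ "]" =>
  (Curve.ofPeriodic (OrbitPolygon.loop β p δ) OrbitPolygon.continuous_loop : Curve ℂ)
local notation3 "uIdx[" Q ", " t "]" => ⌊(Q : ℝ) * ((t : unitInterval) : ℝ)⌋₊
open Summit.CriticalPhenomena.CardyFormulaZ2.Cruxes.NestingRigidity.RingCloudTomography

namespace BondLoopH1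

/-- **From the medial polygon of an interface loop to disjoint open crossings of `ω`.** If the medial
polygon of an interface loop `γ` of `ω ∩ M` at mesh `δ > 0` traverses `D(x; ρ, R)` `2j + 3` times, and
`0 < q₁`, `ρ + 5δ ≤ q₁`, `q₁ + 45δ ≤ R`, then `ω` lies in the `j`-fold disjoint occurrence of the open
crossing of `A(x; q₁ + 11δ, R - 16δ)` (bricks 1 and 4; the restriction only closes edges and the crossing
event is increasing). [cite: AizenmanBurchardDuke1999, Appendix A] -/
theorem mem_disjointOccurrencePow_of_isInterfaceLoop {ω : BondConfig (Site 2)} {M : Set (Sym2 (Site 2))}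
    {γ : List MedialVertex} (h : IsInterfaceLoop (ω ∩ M) γ) {δ : ℝ} (hδ : 0 < δ) {x : ℂ} {ρ R q₁ : ℝ}
    (hq₁ : 0 < q₁) (hρq : ρ + 5 * δ ≤ q₁) (hgap : q₁ + 45 * δ ≤ R) {j : ℕ}
    (htr : (⟨polyline ((γ ++ γ.take 1).map (medialPoint δ))⟩ : Curve ℂ).HasTraversals (2 * j + 3) x ρ R) :
    ω ∈ disjointOccurrencePow (annulusOpenCrossing x δ (q₁ + 11 * δ) (R - 16 * δ)) j := by
  obtain ⟨p, hps, hpt⟩ := h.exists_corner 0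
  have hp : p ∈ periodicPts (nextCorner (ω ∩ M)) := by
    refine h.mem_periodicPts (p := p) ?_
    have := h.getElem_mod_mem_zip 0
    rwa [← hps, ← hpt] at this
  have htr' := hasTraversals_roundedCurve h hps hpt hδ htr
  have hcore := mem_disjointOccurrencePow_of_hasTraversals hp hδ (q₁ := q₁) (q₂ := R - 5 * δ) hq₁ hρq
    (by linarith) le_rfl htr'
  rw [show R - 5 * δ - 11 * δ = R - 16 * δ by ring] at hcore
  exact (isUpperSet_annulusOpenCrossing x δ _ _).disjointOccurrencePow j
    (Set.inter_subset_left.trans Set.inter_subset_left) hcore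

end BondLoopH1

/-- **Registered stub `bond_loop_traversalBound`: hypothesis H1 of Aizenman–Burchard for the critical
bond-percolation loop ensemble on `δℤ²`** (Duke Math. J. 99 (1999), eq. (1.3) and Appendix A, Thm A.1:
"the `k` crossing segments cut the annulus into sectors, each containing an open crossing; RSW and BK").
See the module docstring for the constants and the proof. [cite: AizenmanBurchardDuke1999, §1 (1.3) and Appendix A Thm A.1] -/
theorem bond_loop_traversalBound :
    ∃ (k : ℕ) (K lam : ℝ), 0 ≤ K ∧ 2 < lam ∧ ∀ (M : Set (Sym2 (Site 2))) (δ : ℝ), δ ∈ Set.Ioc (0 : ℝ) 1 →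
      ∀ (x : ℂ) (ρ R : ℝ), δ ≤ ρ → ρ < R → R ≤ 1 →
        bondPercolation (zdGraph 2) half {ω | ∃ γ : List MedialVertex, IsInterfaceLoop (ω ∩ M) γ ∧
          (⟨Literature.Probability.LatticeModels.polyline ((γ ++ γ.take 1).map (medialPoint δ))⟩ : Curve ℂ).HasTraversals
            k x ρ R} ≤ ENNReal.ofReal (K * (ρ / R) ^ lam) := by
  classical
  obtain ⟨α, c₀, hα, hc₀, hone⟩ := annulusOpenCrossing_half_le_holds
  set j : ℕ := ⌈3 / α⌉₊ with hj
  have hjα : 3 ≤ α * j := by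
    have : 3 / α ≤ j := Nat.le_ceil _
    rw [div_le_iff₀ hα] at this
    linarith
  set lam : ℝ := α * j with hlam
  have hlam2 : 2 < lam := by linarith
  have hlam0 : 0 ≤ lam := by linarith
  set C : ℝ := max c₀ 1 + 40 with hC
  have hC40 : 41 ≤ C := by have := le_max_right c₀ 1; linarith
  have hCc₀ : c₀ ≤ C := by have := le_max_left c₀ 1; linarith
  have hC0 : 0 < C := by linarith
  refine ⟨2 * j + 3, (4 * C) ^ lam, lam, by positivity, hlam2, ?_⟩
  intro M δ hδ x ρ R hδρ hρR hR1
  obtain ⟨hδ0, hδ1⟩ := hδ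
  have hρ : 0 < ρ := hδ0.trans_le hδρ
  have hR : 0 < R := hρ.trans hρR
  have hratio : 0 < ρ / R := div_pos hρ hR
  set P := bondPercolation (zdGraph 2) half with hP
  set E : Set (BondConfig (Site 2)) := {ω | ∃ γ : List MedialVertex, IsInterfaceLoop (ω ∩ M) γ ∧
    (⟨Literature.Probability.LatticeModels.polyline ((γ ++ γ.take 1).map (medialPoint δ))⟩ : Curve ℂ).HasTraversals
      (2 * j + 3) x ρ R} with hE
  by_cases hbig : 4 * C * ρ ≤ R
  · -- `j` disjoint open crossings of `A(x; Cρ + 11δ, R - 16δ)`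
    set r₁ : ℝ := C * ρ + 11 * δ with hr₁
    set r₂ : ℝ := R - 16 * δ with hr₂
    have hCρ : 41 * ρ ≤ C * ρ := mul_le_mul_of_nonneg_right hC40 hρ.le
    have hsub : E ⊆ disjointOccurrencePow (annulusOpenCrossing x δ r₁ r₂) j := by
      rintro ω ⟨γ, hγ, htr⟩
      exact BondLoopH1.mem_disjointOccurrencePow_of_isInterfaceLoop hγ hδ0 (q₁ := C * ρ) (by positivity)
        (by nlinarith) (by nlinarith) htr
    -- one crossing
    have hr₁0 : 0 < r₁ := by rw [hr₁]; positivity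
    have hr₂0 : 0 < r₂ := by rw [hr₂]; nlinarith
    have h1 : c₀ * δ ≤ r₁ := by
      rw [hr₁]
      nlinarith [mul_le_mul_of_nonneg_right hCc₀ hρ.le, mul_le_mul_of_nonneg_left hδρ hc₀.le]
    have h2 : 2 * r₁ ≤ r₂ := by rw [hr₁, hr₂]; nlinarith
    have harm : P.real (annulusOpenCrossing x δ r₁ r₂) ≤ (r₁ / r₂) ^ α := hone x δ r₁ r₂ hδ0 h1 h2
    have hθ0 : 0 ≤ r₁ / r₂ := div_nonneg hr₁0.le hr₂0.le
    have hθ : r₁ / r₂ ≤ 4 * C * (ρ / R) := by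
      rw [div_le_iff₀ hr₂0, hr₁, hr₂]
      have e : 4 * C * (ρ / R) * (R - 16 * δ) = 4 * C * ρ - 64 * C * (ρ / R) * δ := by
        field_simp
        ring
      rw [e]
      have hρR' : ρ / R ≤ 1 / (4 * C) := by
        rw [div_le_div_iff₀ hR (by positivity)]; linarith
      have : 64 * C * (ρ / R) * δ ≤ 16 * δ := by
        have := mul_le_mul_of_nonneg_right hρR' (by positivity : (0 : ℝ) ≤ 64 * C * δ)
        rw [show 64 * C * (ρ / R) * δ = ρ / R * (64 * C * δ) by ring]
        refine this.trans (le_of_eq ?_)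
        field_simp
        ring
      nlinarith
    have harm' : P.real (annulusOpenCrossing x δ r₁ r₂) ≤ (4 * C * (ρ / R)) ^ α :=
      harm.trans (Real.rpow_le_rpow hθ0 hθ hα.le)
    -- `j` disjoint crossings
    have hloc := isLocalEvent_annulusOpenCrossing hδ0 x r₁ r₂
    have hpow := measureReal_disjointOccurrencePow_le (zdGraph 2) half hloc j
    have hreal : P.real (disjointOccurrencePow (annulusOpenCrossing x δ r₁ r₂) j) ≤
        (4 * C) ^ lam * (ρ / R) ^ lam := by
      refine (hpow.trans (pow_le_pow_left₀ measureReal_nonneg harm' j)).trans (le_of_eq ?_)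
      rw [rpow_pow_mul_eq (by positivity) hratio.le]
    calc P E ≤ P (disjointOccurrencePow (annulusOpenCrossing x δ r₁ r₂) j) := measure_mono hsub
      _ = ENNReal.ofReal (P.real (disjointOccurrencePow (annulusOpenCrossing x δ r₁ r₂) j)) :=
          (ofReal_measureReal (measure_ne_top _ _)).symm
      _ ≤ ENNReal.ofReal ((4 * C) ^ lam * (ρ / R) ^ lam) := ENNReal.ofReal_le_ofReal hreal
  · -- `R < 4Cρ`: the bound is trivial
    push Not at hbig
    have hge : (1 : ℝ) ≤ (4 * C) ^ lam * (ρ / R) ^ lam := by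
      rw [← Real.mul_rpow (by positivity) hratio.le]
      refine Real.one_le_rpow ?_ hlam0
      rw [← mul_div_assoc, le_div_iff₀ hR]
      linarith
    calc P E ≤ 1 := prob_le_one
      _ = ENNReal.ofReal 1 := ENNReal.ofReal_one.symm
      _ ≤ ENNReal.ofReal ((4 * C) ^ lam * (ρ / R) ^ lam) := ENNReal.ofReal_le_ofReal hge

/-- **Registered anchor `precompactLaw_measurable_zEns` (T1m for `zEns`, unconditional)**: the
Aizenman–Burchard / Camia–Newman `d_CN`-precompactness of the critical `ℤ²` bond loop ensemble presented on
`([0,1], Leb)`, with measurable closeness events against both lattice ensembles at every mesh — the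
conditional soft-machine theorem `precompactLaw_measurable_zEns_of_traversalBound` fed with
`bond_loop_traversalBound`. [cite: AizenmanBurchardDuke1999, Thm 1.2] -/
theorem precompactLaw_measurable_zEns : ∀ δs : ℕ → ℝ, Tendsto δs atTop (𝓝[>] (0 : ℝ)) →
    ∃ φ : ℕ → ℕ, StrictMono φ ∧ ∃ X : unitInterval → LoopConfig ℂ,
      (∀ (δ ε : ℝ), ∀ E' ∈ latticeEnsembles,
        MeasurableSet {p : E'.Ω × unitInterval | LoopConfig.IsClose ε (E'.X δ p.1) (X p.2)}) ∧
      Tendsto (fun k : ℕ ↦ LoopConfig.cnLawEDist zEns.P (zEns.X (δs (φ k))) volume X) atTop (𝓝 0) :=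
  precompactLaw_measurable_zEns_of_traversalBound bond_loop_traversalBound

end Summit.CriticalPhenomena.CardyFormulaZ2.Cruxes.NestingRigidity.PositiveConeWeightDoubling

end
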